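import Literature.NumberTheory.GaloisRepresentations.SuperellipticLambdaTorsionCoprime
import Literature.NumberTheory.EllipticCurves.TateModuleContinuityProofs
import HarnessLib

/-!
# The Galois action on `Pic(C_{f,K̄})` is continuous: `Pic(C_{f,K̄})` and `J(C_f)[n]` are discrete
# `Γ_K`-modules (superelliptic curves `y^p = f(x)`)

The tree's `SuperellipticTorsionRep` builds the mod-`n` Galois representation
`jacobianModPTorsionRep K m f n h` on `J(C_f)[n] = Cl(K̄(C_f)/K̄)[n]` as a `GaloisRep` only under an
explicit hypothesis `h : ContinuousSMul (Field.absoluteGaloisGroup K) (GeomPic K m f)` ("stabilisers of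
divisor classes are open: every class is defined over a finite extension of `K` — a theorem about this
representation which is not proved here").  This file PROVES that hypothesis for the curves of the two
`λ`-torsion theorems (`superelliptic_lambdaTorsion_iso_heart[_of_not_dvd]`): `p` prime, `ζ_p ∈ K`,
`f` separable (`continuousSMul_absoluteGaloisGroup_geomPic`), and records the unconditional
representation `jacobianTorsionGaloisRep K p f hζ hsep n : GaloisRep K (ZMod n) (J(C_f)[n])`.

The content is Serre's axiom (1) of *Cohomologie galoisienne* II §1.1 (`A(K̄) = lim→ A(K_i)` over the
finite sub-extensions, which "entraîne que cette action est continue") for the group of divisor classes,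
proved in the language of places of `L(C_f)/L`, `L ⊇ K` algebraic and algebraically closed:

* `exists_fixingSubgroup_le_stabilizer_place` — **every place is fixed by `Gal(L/E)` for a finite
  `E/K`**, by the description of the fibres of `C_f → ℙ¹` in `SuperellipticTorsionRepProofs` /
  `SuperellipticLambdaTorsionCoprime`: the place `T_α` above a root `α` by `Gal(L/K(α))`
  (`σ T_α = T_{σ α}`); a place `Q` above a non-root `β` by `Gal(L/K(β, c))` where `c = y(Q)`
  (`c^p = f(β)`) is its *label*; a place above `∞` by `Gal(L/K(c))`, `c = (y/x^k)(Q)`, `c^p = lead f`,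
  when `p ∣ deg f = pk`, and by all of `Gal(L/K)` when `p ∤ deg f` (a single place above `∞`).  The key
  step is `smul_eq_self_of_label`: if `σ` fixes `u` and the label `c` of `Q` (`u ≡ c mod Q`) and `σ Q`
  is a deck translate `ζ Q` (the deck group is transitive on unramified fibres, Stichtenoth Thm. 3.7.1),
  then `σ Q = ζ Q` carries the labels `c` and `ζ⁻¹ c`, which must agree, so `ζ = 1`
  (labels exist: `exists_label`, `u^p - c^p = ∏ (u - ζ₀^i c)`).
* `isOpen_stabilizer_place`, `isOpen_stabilizer_divisor` (finite support), `isOpen_stabilizer_pic`,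
  `continuousSMul_algEquiv_superellipticPic` (Mathlib `IntermediateField.fixingSubgroup_isOpen`,
  `continuousSMul_iff_stabilizer_isOpen`), and the `K̄`-specialisations above.

Also here: the Galois action NORMALISES the deck group — `smul_deck_smul : g (ζ z) = g(ζ) (g z)` on
`L(C_f)` — hence commutes with it when `μ_p ⊆ K` (`smul_deck_comm[_place|_divisor|_pic]`,
`smul_mem_lambdaTorsion`: `J[1 - ζ]` is `Gal`-stable; Zarhin §8, `ℤ[ζ_q] ↪ End_K(J)`), and the
`ℓ`-adic Tate module `T_ℓ J(C_f) = TateModule (Pic(C_{f,K̄})) ℓ` as a continuous Galois representation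
`superellipticTateGaloisRep` (tree `TateModule.continuousSMul_of_continuousSMul`), on which the deck
group still commutes with `Γ_K` (`absoluteGaloisGroup_smul_deck_smul_tateModule`); its rank is not
computed.  Everything is proved; the `def`s (`jacobianTorsionGaloisRep`, `superellipticTateGaloisRep`)
package tree representations with the continuity proved here.

## References

* J.-P. Serre, *Galois Cohomology*, Springer (1997), Chap. II §1.1, axiom (1) and Remarque 2
  (discrete `Γ_K`-modules of points). [SerreGaloisCohomology1997]
* H. Stichtenoth, *Algebraic Function Fields and Codes*, 2nd ed., GTM 254 (2009), Lemma 3.5.2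
  (automorphisms permute places), Thm. 3.7.1, Prop. 3.7.3 (Kummer extensions). [Stichtenoth2009]
* J.-P. Serre, J. Tate, *Good reduction of abelian varieties*, Ann. of Math. 88 (1968), §1 p. 493
  (`Gal` acts continuously on `T_l`). [SerreTate1968]
* Yu. G. Zarhin, *Endomorphism algebras of abelian varieties with special reference to superelliptic
  Jacobians*, arXiv:1706.00110, §8 (`δ_q`, `ℤ[ζ_q] → End_K(J^{(f,q)})`). [Zarhin2018SuperellipticJacobians]
-/

noncomputable section

open Polynomial
open scoped Classical Pointwise

namespace Literature.NumberTheory.GaloisRepresentations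

open Literature.NumberTheory.DiophantineGeometry Literature.NumberTheory.DiophantineGeometry.AlgFunctionField

universe u v w

attribute [local instance] Finsupp.comapSMul Finsupp.comapMulAction Finsupp.comapDistribMulAction
attribute [local instance] AddSubgroup.torsionBy.zmodModule

namespace SuperellipticFunctionField

variable {K : Type u} [Field K] {L : Type v} [Field L] [Algebra K L] {p : ℕ} {f : K[X]}
variable [Fact (Irreducible (superellipticPoly K L p f))]

/-! ### Transport of the fibres under automorphisms of `L/K` -/

section GaloisFibres

variable {G : Type w} [Group G] [MulSemiringAction G L] [SMulCommClass G K L]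

/-- **`σ` maps the places above `P_a` to the places above `P_{σ a}`** (`v_{σ Q}(x - σ a) = v_Q(x - a) > 0`).
[cite: Stichtenoth2009, Lemma 3.5.2] -/
theorem restrict_smul_of_restrict_eq_placeXSubC (σ : G) {Q : PlaceOver L (SuperellipticFunctionField K L p f)}
    {a : L} (hQ : Q.restrict (K := L) (F := RatFunc L) = placeXSubC a) :
    (σ • Q).restrict (K := L) (F := RatFunc L) = placeXSubC (σ • a) := by
  refine restrict_eq_placeXSubC_of_ord_pos ?_
  have h : genX K L p f - algebraMap L _ (σ • a) = σ • (genX K L p f - algebraMap L _ a) := by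
    rw [smul_sub, smul_genX, smul_algebraMap_superelliptic]
  rw [h, PlaceOver.ord_smul_smul]
  exact ord_pos_of_restrict_eq_placeXSubC hQ

/-- **`σ Q` lies above `∞` iff `Q` does** (`σ` fixes `x`). [cite: Stichtenoth2009, Lemma 3.5.2] -/
theorem restrict_smul_eq_inftyPlace_iff [IsAlgClosed L] (σ : G) (Q : PlaceOver L (SuperellipticFunctionField K L p f)) :
    (σ • Q).restrict (K := L) (F := RatFunc L) = ratFuncInftyPlace L ↔
      Q.restrict (K := L) (F := RatFunc L) = ratFuncInftyPlace L := by
  rw [restrict_eq_inftyPlace_iff_ord_genX_neg, restrict_eq_inftyPlace_iff_ord_genX_neg]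
  conv_lhs => rw [← smul_genX (K := K) (L := L) (p := p) (f := f) σ, PlaceOver.ord_smul_smul]

/-- The Galois action fixes `y`. [folklore] -/
theorem smul_genY (σ : G) : σ • genY K L p f = genY K L p f :=
  smul_superelliptic_root K L p f σ

/-- The Galois action fixes `y / x^k`. [folklore] -/
theorem smul_genYdivXpow (σ : G) (k : ℕ) :
    σ • (genY K L p f * (genX K L p f)⁻¹ ^ k) = genY K L p f * (genX K L p f)⁻¹ ^ k := by
  rw [smul_mul', smul_pow', smul_inv'', smul_genX, smul_genY]

end GaloisFibres

/-! ## The Galois action and the deck group -/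

section DeckGalois

variable {G : Type w} [Group G] [MulSemiringAction G L] [SMulCommClass G K L]

/-! ### `g ∘ ζ = g(ζ) ∘ g`: the Galois action normalises the deck group -/

/-- **`g (ζ z) = g(ζ) (g z)`** on `L(C_f)` for an automorphism `g` of `L/K` and a deck transformation
`y ↦ ζ y`: both sides are ring endomorphisms of `L(x)[y]/(y^p - f)` agreeing on `L(x)` and on `y`
(`g(ζ y) = g(ζ) y`). [folklore] -/
theorem smul_deck_smul (g : G) (ζ : CyclicCoverDeck L p) (z : SuperellipticFunctionField K L p f) :
    g • (ζ • z) = (CyclicCoverDeck.galConj g ζ) • (g • z) := by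
  set φ₁ : (RatFunc L)[X] →+* SuperellipticFunctionField K L p f :=
    ((MulSemiringAction.toRingHom G _ g).comp (MulSemiringAction.toRingHom (CyclicCoverDeck L p) _ ζ)).comp
      (AdjoinRoot.mk (superellipticPoly K L p f)) with hφ₁
  set φ₂ : (RatFunc L)[X] →+* SuperellipticFunctionField K L p f :=
    ((MulSemiringAction.toRingHom (CyclicCoverDeck L p) _ (CyclicCoverDeck.galConj g ζ)).comp
      (MulSemiringAction.toRingHom G _ g)).comp (AdjoinRoot.mk (superellipticPoly K L p f)) with hφ₂
  have hφ : φ₁ = φ₂ := by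
    refine Polynomial.ringHom_ext (fun r => ?_) ?_
    · show g • (ζ • AdjoinRoot.mk (superellipticPoly K L p f) (C r)) =
        (CyclicCoverDeck.galConj g ζ) • (g • AdjoinRoot.mk (superellipticPoly K L p f) (C r))
      rw [AdjoinRoot.mk_C, deck_smul_of, smul_superelliptic_of, deck_smul_of]
    · show g • (ζ • AdjoinRoot.mk (superellipticPoly K L p f) X) =
        (CyclicCoverDeck.galConj g ζ) • (g • AdjoinRoot.mk (superellipticPoly K L p f) X)
      rw [AdjoinRoot.mk_X, deck_smul_root, smul_mul', smul_algebraMap_superelliptic, smul_superelliptic_root,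
        deck_smul_root, CyclicCoverDeck.val_galConj]
  obtain ⟨q, rfl⟩ := AdjoinRoot.mk_surjective z
  exact RingHom.congr_fun hφ q

/-- **When `μ_p ⊆ K` the Galois action fixes the deck group**: `g(ζ) = ζ` (every `p`-th root of unity
of `L` is a power of the primitive one coming from `K`). [folklore] -/
theorem galConj_eq_self [NeZero p] {ζK : K} (hζK : IsPrimitiveRoot ζK p) (g : G) (ζ : CyclicCoverDeck L p) :
    CyclicCoverDeck.galConj g ζ = ζ := by
  apply CyclicCoverDeck.val_injective
  rw [CyclicCoverDeck.val_galConj]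
  have hζL : IsPrimitiveRoot (algebraMap K L ζK) p := hζK.map_of_injective (algebraMap K L).injective
  obtain ⟨j, -, hj⟩ := hζL.eq_pow_of_pow_eq_one (CyclicCoverDeck.val_pow ζ)
  rw [← hj, smul_pow', smul_algebraMap]

/-- **The Galois and deck actions on `L(C_f)` commute** when `μ_p ⊆ K`. [folklore] -/
theorem smul_deck_comm [NeZero p] {ζK : K} (hζK : IsPrimitiveRoot ζK p) (g : G) (ζ : CyclicCoverDeck L p)
    (z : SuperellipticFunctionField K L p f) : g • (ζ • z) = ζ • (g • z) := by
  rw [smul_deck_smul, galConj_eq_self hζK]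

/-- The Galois and deck actions on the places of `L(C_f)/L` commute (`μ_p ⊆ K`). [folklore] -/
theorem smul_deck_comm_place [NeZero p] {ζK : K} (hζK : IsPrimitiveRoot ζK p) (g : G) (ζ : CyclicCoverDeck L p)
    (Q : PlaceOver L (SuperellipticFunctionField K L p f)) : g • (ζ • Q) = ζ • (g • Q) := by
  apply PlaceOver.ext
  ext z
  rw [toValuationSubring_smul, toValuationSubring_smul, toValuationSubring_smul, toValuationSubring_smul,
    ValuationSubring.mem_pointwise_smul_iff_inv_smul_mem, ValuationSubring.mem_pointwise_smul_iff_inv_smul_mem,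
    ValuationSubring.mem_pointwise_smul_iff_inv_smul_mem, ValuationSubring.mem_pointwise_smul_iff_inv_smul_mem,
    smul_deck_comm hζK]

/-- The Galois and deck actions on divisors commute (`μ_p ⊆ K`). [folklore] -/
theorem smul_deck_comm_divisor [NeZero p] {ζK : K} (hζK : IsPrimitiveRoot ζK p) (g : G) (ζ : CyclicCoverDeck L p)
    (D : Divisor L (SuperellipticFunctionField K L p f)) : g • (ζ • D) = ζ • (g • D) := by
  ext Q
  rw [smul_divisor_apply, smul_divisor_apply, smul_divisor_apply, smul_divisor_apply, smul_deck_comm_place hζK]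

/-- **The Galois and deck actions on `Pic(C_{f,L})` commute** when `μ_p ⊆ K`: the automorphism
`δ` of the Jacobian is defined over `K`, so `ℤ[ζ_p] ↪ End_K(J)` and the `ζ`-eigenspaces /
`(1 - ζ)`-torsion are `Gal`-stable (Zarhin §8: `δ_q … ℤ[ζ_q] → End_K(J^{(f,q)})`).
[cite: Zarhin2018SuperellipticJacobians, §8] -/
theorem smul_deck_comm_pic [NeZero p] {ζK : K} (hζK : IsPrimitiveRoot ζK p) (g : G) (ζ : CyclicCoverDeck L p)
    (c : SuperellipticPic K L p f) : g • (ζ • c) = ζ • (g • c) := by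
  obtain ⟨D, rfl⟩ := SuperellipticPic.mk_surjective c
  rw [SuperellipticPic.deck_smul_mk, SuperellipticPic.smul_mk, SuperellipticPic.smul_mk, SuperellipticPic.deck_smul_mk,
    smul_deck_comm_divisor hζK]

/-- Over an algebraically closed constant field automorphisms preserve degrees of divisors (all
places are rational). [folklore] -/
theorem degree_smul_divisor [IsAlgClosed L] (g : G) (D : Divisor L (SuperellipticFunctionField K L p f)) :
    (g • D).degree = D.degree := by
  induction D using Finsupp.induction with
  | zero => rw [smul_zero]
  | single_add v n D _ _ ih =>
    have h1 : (g • v).degree = 1 := PlaceOver.isRational_of_isAlgClosed _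
    have h2 : v.degree = 1 := PlaceOver.isRational_of_isAlgClosed _
    rw [smul_add, map_add, map_add, ih, Finsupp.comapSMul_single, Divisor.degree_single, Divisor.degree_single, h1, h2]

/-- The Galois action preserves the degree on `Pic(C_{f,L})` (`L` algebraically closed). [folklore] -/
theorem degree_smul_pic [IsAlgClosed L] (g : G) (c : SuperellipticPic K L p f) :
    SuperellipticPic.degree K L p f (g • c) = SuperellipticPic.degree K L p f c := by
  obtain ⟨D, rfl⟩ := SuperellipticPic.mk_surjective c
  rw [SuperellipticPic.smul_mk, SuperellipticPic.degree_mk, SuperellipticPic.degree_mk, degree_smul_divisor]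

/-- **`J[1 - ζ]` is `Gal`-stable** (`μ_p ⊆ K`, `L` algebraically closed). [cite: Zarhin2018SuperellipticJacobians, §8] -/
theorem smul_mem_lambdaTorsion [IsAlgClosed L] [NeZero p] {ζK : K} (hζK : IsPrimitiveRoot ζK p) (g : G)
    {c : SuperellipticPic K L p f} (hc : c ∈ lambdaTorsion K L p f) : g • c ∈ lambdaTorsion K L p f := by
  obtain ⟨hdeg, hfix⟩ := (mem_lambdaTorsion K L p f).1 hc
  exact (mem_lambdaTorsion K L p f).2
    ⟨by rw [degree_smul_pic, hdeg], fun ζ => by rw [← smul_deck_comm_pic hζK, hfix ζ]⟩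

end DeckGalois

/-! ### Labels of the places of an unramified fibre -/

section Labels

variable [hp : Fact p.Prime]

/-- **Existence of a label**: if `u ∈ O_Q` and `u^p ≡ c₀ ≢ 0 (mod Q)`, and `L ∋ ζ₀` (primitive `p`-th
root of unity) is algebraically closed, then `u ≡ c (mod Q)` for some `p`-th root `c` of `c₀`
(`u^p - c₀ = ∏ (u - ζ₀^i b₀)`). [cite: Stichtenoth2009, Prop. 3.7.3] -/
theorem exists_label [IsAlgClosed L] {ζ₀ : L} (hζ₀ : IsPrimitiveRoot ζ₀ p)
    {Q : PlaceOver L (SuperellipticFunctionField K L p f)} {u : SuperellipticFunctionField K L p f} {c₀ : L}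
    (huQ : u ∈ Q.toValuationSubring) (hlt : Q.valuation (u ^ p - algebraMap L _ c₀) < 1) :
    ∃ c : L, c ^ p = c₀ ∧ Q.valuation (u - algebraMap L _ c) < 1 := by
  set ι := algebraMap L (SuperellipticFunctionField K L p f) with hι
  obtain ⟨b₀, hb₀⟩ := IsAlgClosed.exists_pow_nat_eq c₀ hp.out.pos
  have hζ₀' : IsPrimitiveRoot (ι ζ₀) p := hζ₀.map_of_injective (algebraMap L _).injective
  have hprod : ∏ i ∈ Finset.range p, (u - ι (ζ₀ ^ i * b₀)) = u ^ p - ι c₀ := by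
    have h := X_pow_sub_C_eq_prod hζ₀' hp.out.pos (show ι b₀ ^ p = ι c₀ by rw [← map_pow, hb₀])
    have h2 := congrArg (eval u) h
    rw [eval_sub, eval_pow, eval_X, eval_C, eval_prod] at h2
    rw [h2]
    refine Finset.prod_congr rfl fun i _ => ?_
    rw [eval_sub, eval_X, eval_C, map_mul, map_pow]
  by_contra hne
  push Not at hne
  rw [← hprod, map_prod] at hlt
  have hall : ∀ i ∈ Finset.range p, Q.valuation (u - ι (ζ₀ ^ i * b₀)) = 1 := fun i _ => by
    refine le_antisymm ((Q.toValuationSubring.valuation_le_one_iff _).2 (sub_mem huQ (Q.algebraMap_mem _))) ?_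
    have hroot : (ζ₀ ^ i * b₀) ^ p = c₀ := by
      rw [mul_pow, ← pow_mul, mul_comm i p, pow_mul, hζ₀.pow_eq_one, one_pow, one_mul, hb₀]
    exact hne _ hroot
  rw [Finset.prod_eq_one hall] at hlt
  exact lt_irrefl _ hlt


omit hp in
/-- **The label determines the place, Galois form.**  Let `Q` be a place, `u ∈ L(C_f)` with
`ζ u = ζ · u` for the deck group, and `c ∈ L^×` a label of `Q` (`u ≡ c (mod Q)`).  If an automorphism
`σ` of `L(C_f)` coming from `Aut(L/K)` fixes `u` and `c`, and `σ Q` is a deck translate `ζ Q` of `Q`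
(e.g. `σ Q` and `Q` lie above the same unramified point), then `σ Q = Q`: the place `σ Q = ζ Q` has the
labels `σ c = c` and `ζ⁻¹ c`, labels are unique, so `ζ = 1`. [cite: Stichtenoth2009, Thm. 3.7.1] -/
theorem smul_eq_self_of_label {G : Type w} [Group G] [MulSemiringAction G L] [SMulCommClass G K L]
    (σ : G) {Q : PlaceOver L (SuperellipticFunctionField K L p f)} {u : SuperellipticFunctionField K L p f}
    {c : L} (hc : c ≠ 0) (htrans : ∃ ζ : CyclicCoverDeck L p, ζ • Q = σ • Q)
    (hζu : ∀ ζ : CyclicCoverDeck L p, ζ • u = algebraMap L _ ζ.val * u)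
    (hlab : Q.valuation (u - algebraMap L _ c) < 1) (hσu : σ • u = u) (hσc : σ • c = c) : σ • Q = Q := by
  obtain ⟨ζ, hζ⟩ := htrans
  -- the label of `ζ • Q = σ • Q`, computed in two ways
  have h1 : (ζ • Q).valuation (u - algebraMap L _ (ζ.val⁻¹ * c)) < 1 := valuation_deck_smul_sub_lt_one hζu hlab ζ
  have h2 : (σ • Q).valuation (u - algebraMap L _ c) < 1 := by
    have h := (valuation_smul_smul_lt_one_iff σ Q (u - algebraMap L _ c)).2 hlab
    rwa [smul_sub, hσu, smul_algebraMap_superelliptic, hσc] at h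
  rw [hζ] at h1
  -- hence the labels agree
  have heq : ζ.val⁻¹ * c = c := by
    by_contra hne
    have h3 : (σ • Q).valuation ((u - algebraMap L _ c) - (u - algebraMap L _ (ζ.val⁻¹ * c))) < 1 :=
      lt_of_le_of_lt (Valuation.map_sub _ _ _) (max_lt h2 h1)
    rw [sub_sub_sub_cancel_left, ← map_sub, PlaceOver.valuation_algebraMap_eq_one _ (sub_ne_zero.2 hne)] at h3
    exact lt_irrefl _ h3
  -- and `ζ = 1`
  have hval : ζ.val = 1 := by
    have h4 : ζ.val⁻¹ = 1 := mul_right_cancel₀ hc (heq.trans (one_mul c).symm)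
    rw [← inv_inv ζ.val, h4, inv_one]
  have hζ1 : ζ = 1 := CyclicCoverDeck.val_injective (by rw [hval, CyclicCoverDeck.val_one])
  rw [← hζ, hζ1, one_smul]

end Labels

/-! ### Stabilisers of places, divisors and divisor classes are open -/

section Stabilizer

variable [IsAlgClosed L] [Algebra.IsAlgebraic K L] [hp : Fact p.Prime]

/-- **Every place of `K̄(C_f)/K̄` is fixed by an open subgroup of `Gal(K̄/K)`** — precisely, by
`Gal(K̄/E)` for a finite extension `E/K`: the place `T_α` above a root by `Gal(K̄/K(α))`
(`σ T_α = T_{σ α}`); a place above a non-root `β` by `Gal(K̄/K(β, c))`, `c = y(Q)` its label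
(`c^p = f(β)`); a place above `∞` by `Gal(K̄/K(c))`, `c = (y/x^k)(Q)`, `c^p = lead f`, when
`p ∣ deg f = pk`, and by everything when `p ∤ deg f` (one place above `∞`).  This is the statement
that the closed points of `C_f` are defined over finite extensions of `K` (Serre, *Cohomologie
galoisienne* II §1.1, axiom (1)), in the language of places. [cite: Stichtenoth2009, Thm. 3.7.1] -/
theorem exists_fixingSubgroup_le_stabilizer_place {ζ₀ : L} (hζ₀ : IsPrimitiveRoot ζ₀ p) (hsep : f.Separable)
    (Q : PlaceOver L (SuperellipticFunctionField K L p f)) :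
    ∃ E : IntermediateField K L, FiniteDimensional K E ∧
      E.fixingSubgroup ≤ MulAction.stabilizer (L ≃ₐ[K] L) Q := by
  have hf : f ≠ 0 := hsep.ne_zero
  have hint : ∀ x : L, IsIntegral K x := fun x => Algebra.IsIntegral.isIntegral x
  rcases eq_ratFuncInftyPlace_or_exists_eq_placeXSubC L (Q.restrict (K := L) (F := RatFunc L)) with h | ⟨b, hb⟩
  · -- above `∞`
    by_cases hdvd : p ∣ f.natDegree
    · -- `p ∣ deg f`: labels `u = y / x^k`, `c^p = lead f`
      obtain ⟨k, hk⟩ := hdvd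
      have hlead : (f.map (algebraMap K L)).leadingCoeff ≠ 0 :=
        leadingCoeff_ne_zero.2 ((Polynomial.map_ne_zero_iff (algebraMap K L).injective).2 hf)
      obtain ⟨huQ, hlt⟩ := genYdivXpow_mem_and_valuation_lt_one hk hf h
      obtain ⟨c, hcp, hlab⟩ := exists_label hζ₀ huQ hlt
      have hc0 : c ≠ 0 := by rintro rfl; rw [zero_pow hp.out.ne_zero] at hcp; exact hlead hcp.symm
      refine ⟨IntermediateField.adjoin K {c}, IntermediateField.adjoin.finiteDimensional (hint c), fun σ hσ => ?_⟩
      have hσc : σ • c = c :=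
        (IntermediateField.mem_fixingSubgroup_iff _ _).1 hσ c (IntermediateField.mem_adjoin_simple_self K c)
      rw [MulAction.mem_stabilizer_iff]
      refine smul_eq_self_of_label σ hc0 ?_ (deck_smul_genYdivXpow k) hlab (smul_genYdivXpow σ k) hσc
      exact exists_deck_smul_eq_of_restrict_eq_inftyPlace hζ₀ ⟨k, hk⟩ hf h
        ((restrict_smul_eq_inftyPlace_iff σ Q).2 h)
    · -- `p ∤ deg f`: the unique place above `∞` is fixed by everything
      refine ⟨IntermediateField.adjoin K {(0 : L)}, IntermediateField.adjoin.finiteDimensional (hint 0),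
        fun σ _ => ?_⟩
      rw [MulAction.mem_stabilizer_iff, eq_inftyPlace_of_restrict_eq hdvd h, smul_inftyPlace hdvd σ]
  · by_cases hbr : (f.map (algebraMap K L)).IsRoot b
    · -- `Q = T_b`, `σ T_b = T_{σ b}`
      refine ⟨IntermediateField.adjoin K {b}, IntermediateField.adjoin.finiteDimensional (hint b), fun σ hσ => ?_⟩
      have hσb : σ • b = b :=
        (IntermediateField.mem_fixingSubgroup_iff _ _).1 hσ b (IntermediateField.mem_adjoin_simple_self K b)
      rw [MulAction.mem_stabilizer_iff, eq_rootPlace_of_restrict_eq hsep hbr hb, smul_rootPlace hsep σ hbr, hσb]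
    · -- above a non-root `b`: labels `u = y`, `c^p = f(b)`
      have hβ : (f.map (algebraMap K L)).eval b ≠ 0 := hbr
      obtain ⟨huQ, hlt⟩ := genY_mem_and_valuation_lt_one_of_eval_ne_zero hβ hb
      obtain ⟨c, hcp, hlab⟩ := exists_label hζ₀ huQ hlt
      have hc0 : c ≠ 0 := by rintro rfl; rw [zero_pow hp.out.ne_zero] at hcp; exact hβ hcp.symm
      haveI : Finite ({b, c} : Set L) := Set.toFinite _ |>.to_subtype
      refine ⟨IntermediateField.adjoin K {b, c}, IntermediateField.finiteDimensional_adjoin (fun x _ => hint x),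
        fun σ hσ => ?_⟩
      have hσ' := (IntermediateField.mem_fixingSubgroup_iff _ _).1 hσ
      have hσb : σ • b = b := hσ' b (IntermediateField.subset_adjoin K _ (Set.mem_insert b {c}))
      have hσc : σ • c = c := hσ' c (IntermediateField.subset_adjoin K _ (Set.mem_insert_of_mem b rfl))
      rw [MulAction.mem_stabilizer_iff]
      refine smul_eq_self_of_label σ hc0 ?_ deck_smul_genY hlab (smul_genY σ) hσc
      refine exists_deck_smul_eq_of_eval_ne_zero hζ₀ hβ hb ?_
      rw [restrict_smul_of_restrict_eq_placeXSubC σ hb, hσb]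

/-- **Stabilisers of places are open** in `Gal(L/K)` (Krull topology): they contain the open subgroup
`Gal(L/E)` of `exists_fixingSubgroup_le_stabilizer_place` (Mathlib `IntermediateField.fixingSubgroup_isOpen`).
[cite: Stichtenoth2009, Thm. 3.7.1] -/
theorem isOpen_stabilizer_place {ζ₀ : L} (hζ₀ : IsPrimitiveRoot ζ₀ p) (hsep : f.Separable)
    (Q : PlaceOver L (SuperellipticFunctionField K L p f)) :
    IsOpen ((MulAction.stabilizer (L ≃ₐ[K] L) Q : Subgroup (L ≃ₐ[K] L)) : Set (L ≃ₐ[K] L)) := by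
  obtain ⟨E, hE, hle⟩ := exists_fixingSubgroup_le_stabilizer_place hζ₀ hsep Q
  exact Subgroup.isOpen_mono hle E.fixingSubgroup_isOpen

/-- **Stabilisers of divisors are open**: an automorphism fixing every place in the (finite) support of
`D` fixes `D`, and a finite intersection of open subgroups is open. [folklore] -/
theorem isOpen_stabilizer_divisor {ζ₀ : L} (hζ₀ : IsPrimitiveRoot ζ₀ p) (hsep : f.Separable)
    (D : Divisor L (SuperellipticFunctionField K L p f)) :
    IsOpen ((MulAction.stabilizer (L ≃ₐ[K] L) D : Subgroup (L ≃ₐ[K] L)) : Set (L ≃ₐ[K] L)) := by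
  have hle : (⨅ Q ∈ D.support, MulAction.stabilizer (L ≃ₐ[K] L) Q) ≤ MulAction.stabilizer (L ≃ₐ[K] L) D := by
    intro σ hσ
    have hfix : ∀ Q ∈ D.support, σ • Q = Q := fun Q hQ => by
      have h := Subgroup.mem_iInf.1 hσ Q
      rw [Subgroup.mem_iInf] at h
      exact h hQ
    rw [MulAction.mem_stabilizer_iff]
    ext Q'
    rw [smul_divisor_apply]
    by_cases hQ' : σ⁻¹ • Q' ∈ D.support
    · have h := hfix _ hQ'
      rw [smul_inv_smul] at h
      rw [← h]
    · by_cases hQ'' : Q' ∈ D.support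
      · have h := hfix _ hQ''
        have h' : σ⁻¹ • Q' = Q' := by rw [inv_smul_eq_iff]; exact h.symm
        rw [h']
      · rw [Finsupp.notMem_support_iff.1 hQ', Finsupp.notMem_support_iff.1 hQ'']
  refine Subgroup.isOpen_mono hle ?_
  rw [Subgroup.coe_iInf]
  simp only [Subgroup.coe_iInf]
  exact isOpen_biInter_finset fun Q _ => isOpen_stabilizer_place hζ₀ hsep Q

/-- **Stabilisers of divisor classes are open.** [folklore] -/
theorem isOpen_stabilizer_pic {ζ₀ : L} (hζ₀ : IsPrimitiveRoot ζ₀ p) (hsep : f.Separable) (c : SuperellipticPic K L p f) :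
    IsOpen ((MulAction.stabilizer (L ≃ₐ[K] L) c : Subgroup (L ≃ₐ[K] L)) : Set (L ≃ₐ[K] L)) := by
  obtain ⟨D, rfl⟩ := SuperellipticPic.mk_surjective c
  refine Subgroup.isOpen_mono (fun σ hσ => ?_) (isOpen_stabilizer_divisor hζ₀ hsep D)
  rw [MulAction.mem_stabilizer_iff] at hσ ⊢
  rw [SuperellipticPic.smul_mk, hσ]

/-- **The Galois action on `Pic(C_{f,L})` is continuous** for the Krull topology on `Gal(L/K)` and the
discrete topology on `Pic` (`L ⊇ K` algebraic and algebraically closed, `ζ_p ∈ L`, `f` separable):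
all stabilisers are open (Mathlib `continuousSMul_iff_stabilizer_isOpen`). [folklore] -/
theorem continuousSMul_algEquiv_superellipticPic {ζ₀ : L} (hζ₀ : IsPrimitiveRoot ζ₀ p) (hsep : f.Separable) :
    ContinuousSMul (L ≃ₐ[K] L) (SuperellipticPic K L p f) :=
  continuousSMul_iff_stabilizer_isOpen.2 fun c => isOpen_stabilizer_pic hζ₀ hsep c

end Stabilizer

end SuperellipticFunctionField

/-! ### The theorem for `Gal(K̄/K)` and the mod-`n` representations on `J(C_f)[n]` -/

section AbsoluteGalois

variable (K : Type u) [Field K] (p : ℕ) [hp : Fact p.Prime] (f : K[X])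
variable [Fact (Irreducible (superellipticPoly K (AlgebraicClosure K) p f))]

/-- **`Pic(C_{f,K̄})` is a discrete `Γ_K`-module**: the action of `Gal(K̄/K)` on the divisor classes of
`K̄(C_f)`, `C_f : y^p = f(x)` (`p` prime, `ζ_p ∈ K`, `f` separable), is continuous for the Krull
topology — every class is fixed by `Gal(K̄/E)` for a finite extension `E/K`.  This discharges the
explicit continuity hypothesis of `jacobianModPTorsionRep`. [folklore] -/
theorem continuousSMul_absoluteGaloisGroup_geomPic (hζ : ∃ ζ : K, IsPrimitiveRoot ζ p) (hsep : f.Separable) :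
    ContinuousSMul (Field.absoluteGaloisGroup K) (GeomPic K p f) := by
  obtain ⟨ζK, hζK⟩ := hζ
  have hζ₀ : IsPrimitiveRoot (algebraMap K (AlgebraicClosure K) ζK) p :=
    hζK.map_of_injective (algebraMap K (AlgebraicClosure K)).injective
  exact SuperellipticFunctionField.continuousSMul_algEquiv_superellipticPic (K := K) (L := AlgebraicClosure K) hζ₀ hsep

/-- **`J(C_f)[n]` as a continuous Galois representation**, unconditionally: the tree's
`jacobianModPTorsionRep` with its continuity hypothesis discharged by
`continuousSMul_absoluteGaloisGroup_geomPic`. [folklore] -/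
def jacobianTorsionGaloisRep (hζ : ∃ ζ : K, IsPrimitiveRoot ζ p) (hsep : f.Separable) (n : ℕ) :
    GaloisRep K (ZMod n) (geomJacobianTorsion K p f n) :=
  jacobianModPTorsionRep K p f n (continuousSMul_absoluteGaloisGroup_geomPic K p f hζ hsep)

/-- The representation underlying `jacobianTorsionGaloisRep` is `jacobianModPTorsionRepresentation`. [folklore] -/
@[simp]
theorem jacobianTorsionGaloisRep_toRepresentation (hζ : ∃ ζ : K, IsPrimitiveRoot ζ p) (hsep : f.Separable) (n : ℕ) :
    (jacobianTorsionGaloisRep K p f hζ hsep n).toRepresentation = jacobianModPTorsionRepresentation K p f n :=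
  rfl

/-! ### The `ℓ`-adic Tate module `T_ℓ J(C_f)` as a continuous Galois representation -/

open Literature.NumberTheory.EllipticCurves in
/-- **The `ℓ`-adic Tate module of the Jacobian of `C_f : y^p = f(x)` as a continuous Galois
representation** `Γ_K → Aut_{ℤ_ℓ}(T_ℓ J(C_f))`: `T_ℓ J(C_f) := TateModule (Pic(C_{f,K̄})) ℓ = lim← Pic[ℓⁿ]`
(the tree's generic Tate module; `Pic / Pic⁰ ≅ ℤ` being torsion-free, `Pic[ℓⁿ] = J[ℓⁿ]`), with the
coordinatewise action, jointly continuous for the Krull and profinite topologies because `Pic(C_{f,K̄})`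
is a discrete `Γ_K`-module (`continuousSMul_absoluteGaloisGroup_geomPic`,
`TateModule.continuousSMul_of_continuousSMul`) — the function-field incarnation of `T_ℓ` of the
Jacobian (Serre–Tate §1: "the group `Gal(K_s/K)` acts continuously on `T_l(A)`"), here for `p` prime,
`ζ_p ∈ K`, `f` separable.  Its rank is NOT computed here. [cite: SerreTate1968, §1 p. 493] -/
def superellipticTateGaloisRep (hζ : ∃ ζ : K, IsPrimitiveRoot ζ p) (hsep : f.Separable) (ℓ : ℕ) [Fact ℓ.Prime] :
    GaloisRep K ℤ_[ℓ] (TateModule (GeomPic K p f) ℓ) :=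
  ⟨tateRepresentation (Field.absoluteGaloisGroup K) (GeomPic K p f) ℓ, by
    haveI := continuousSMul_absoluteGaloisGroup_geomPic K p f hζ hsep
    haveI := TateModule.continuousSMul_of_continuousSMul (A := GeomPic K p f) (p := ℓ)
      (G := Field.absoluteGaloisGroup K)
    exact continuous_smul⟩

open Literature.NumberTheory.EllipticCurves in
/-- The representation underlying `superellipticTateGaloisRep` is the tree's `tateRepresentation`
(`ρ(σ) a = σ • a` coordinatewise). [folklore] -/
@[simp]
theorem superellipticTateGaloisRep_toRepresentation (hζ : ∃ ζ : K, IsPrimitiveRoot ζ p) (hsep : f.Separable)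
    (ℓ : ℕ) [Fact ℓ.Prime] :
    (superellipticTateGaloisRep K p f hζ hsep ℓ).toRepresentation =
      tateRepresentation (Field.absoluteGaloisGroup K) (GeomPic K p f) ℓ :=
  rfl

/-- **The deck group commutes with `Γ_K` on `Pic(C_{f,K̄})`** (`ζ_p ∈ K`): `σ (ζ c) = ζ (σ c)`.
[cite: Zarhin2018SuperellipticJacobians, §8] -/
theorem absoluteGaloisGroup_smul_deck_smul (hζ : ∃ ζ : K, IsPrimitiveRoot ζ p) (σ : Field.absoluteGaloisGroup K)
    (ζ : CyclicCoverDeck (AlgebraicClosure K) p) (c : GeomPic K p f) : σ • (ζ • c) = ζ • (σ • c) := by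
  haveI : NeZero p := ⟨hp.out.ne_zero⟩
  obtain ⟨ζK, hζK⟩ := hζ
  exact SuperellipticFunctionField.smul_deck_comm_pic hζK σ ζ c

open Literature.NumberTheory.EllipticCurves in
/-- **The deck group commutes with `Γ_K` on `T_ℓ J(C_f)`** (`ζ_p ∈ K`): the `ℤ_ℓ[μ_p]`-module structure of
the Tate module is `Γ_K`-equivariant (coordinatewise from `absoluteGaloisGroup_smul_deck_smul`).
[cite: Zarhin2018SuperellipticJacobians, §8] -/
theorem absoluteGaloisGroup_smul_deck_smul_tateModule (hζ : ∃ ζ : K, IsPrimitiveRoot ζ p)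
    (ℓ : ℕ) [Fact ℓ.Prime] (σ : Field.absoluteGaloisGroup K) (ζ : CyclicCoverDeck (AlgebraicClosure K) p)
    (a : TateModule (GeomPic K p f) ℓ) : σ • (ζ • a) = ζ • (σ • a) := by
  refine TateModule.ext fun n => ?_
  rw [TateModule.proj_smul_of_distribMulAction, TateModule.proj_smul_of_distribMulAction,
    TateModule.proj_smul_of_distribMulAction, TateModule.proj_smul_of_distribMulAction,
    absoluteGaloisGroup_smul_deck_smul K p f hζ]

end AbsoluteGalois

end Literature.NumberTheory.GaloisRepresentations
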